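import Literature.AlgebraicTopology.SingularHomology.CechNerveFunctions
import Mathlib.Topology.LocallyConstant.Basic
import HarnessLib

/-!
# Exactness of the Čech complex of functions on the nerve of a good cover

Topic `AlgebraicTopology/SingularHomology`; namespace
`Literature.AlgebraicTopology.SingularHomology` (grouping sub-namespace `CechNerve`).  Theorems
only (no definition, no named fact, no instance, no `sorry`); sequel of `CechNerveFunctions`,
which sets up the nerve `N_p(𝔘)`, the complex `0 → M → Fun(N₀, M) → Fun(N₁, M) → ⋯`
(`cechFunCoaug`, `cechFunD`) and its comparison `cechTheta` with the Čech complex of `0`-cocycles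
of the tree's `CechSingular`.

* `CechNerve.cechFunD_exact_succ` — **for an OPEN cover of a CONTRACTIBLE space all of whose
  non-empty finite intersections are contractible, `Fun(N_p, M) → Fun(N_{p+1}, M) → Fun(N_{p+2}, M)`
  is exact for every `p`**: by the Čech–singular comparison (`cechSingularEquiv`, Leray's
  acyclic-cover theorem for singular cochains, [BottTu1982Forms, Thm. 15.8]) and the small-cochain
  theorem (`dualSmallHomologyIso`, Hatcher Prop. 2.21), `Ȟ^{p+1}(𝔘, Z⁰) ≅ H^{p+1}(X; M) = 0`;
* `CechNerve.cechFunCoaug_exact` — `0 → M → Fun(N₀, M) → Fun(N₁, M)` is exact for an open cover of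
  a connected space (a function of the index compatible on overlaps is locally constant on `X`);
  `CechNerve.cechFunCoaug_injective`.

This is the cochain form, with arbitrary coefficients in the universe of the ring, of the
acyclicity of the nerve of a good cover ([BottTu1982Forms, Thm. 8.9 / 15.8];
[Brown1982CohomologyGroups, VII §4]).

## References

* R. Bott, L. W. Tu, *Differential Forms in Algebraic Topology*, GTM 82 (1982), §8 Thm. 8.9, §15
  Thm. 15.8 [BottTu1982Forms].
* A. Hatcher, *Algebraic Topology*, CUP 2002, §2.1 Prop. 2.21, §3.1 pp. 197–201 [HatcherAT2002].
* K. S. Brown, *Cohomology of Groups*, GTM 87 (1982), VII §4 [Brown1982CohomologyGroups].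
-/

noncomputable section

open CategoryTheory Limits

universe u

namespace Literature.AlgebraicTopology.SingularHomology

namespace CechNerve

variable {R : Type u} [CommRing R] {X : Type u} {M : Type u} [AddCommGroup M] [Module R M]
  {ι : Type u} {U : ι → Set X}

section Topology

variable [TopologicalSpace X]

/-- The acyclicity hypothesis of the Čech–singular comparison for a family all of whose non-empty
finite intersections are contractible. [cite: BottTu1982Forms, Thm. 15.8] -/
theorem hacyc_of_contractible
    (hgood : ∀ (p : ℕ) (J : Fin (p + 1) → ι), (cechSet U J).Nonempty → ContractibleSpace ↥(cechSet U J))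
    (p q : ℕ) (J : Fin (p + 1) → ι) (ψ : CochainOn R M (cechSet U J) (q + 1))
    (hψ : cod (cechSet U J) (q + 1) ψ = 0) :
    ∃ φ : CochainOn R M (cechSet U J) q, cod (cechSet U J) q φ = ψ := by
  by_cases h : (cechSet U J).Nonempty
  · haveI := hgood p J h
    exact exists_cod_eq_of_isZero_homology (cechSet U J)
      (isZero_homology_subsetCochains_of_contractibleSpace (cechSet U J) (Nat.succ_ne_zero q)) ψ hψ
  · exact exists_cod_eq_of_eq_empty (Set.not_nonempty_iff_eq_empty.1 h) ψ

/-- Non-empty finite intersections are path connected when they are contractible. [folklore] -/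
theorem isPathConnected_of_hgood
    (hgood : ∀ (p : ℕ) (J : Fin (p + 1) → ι), (cechSet U J).Nonempty → ContractibleSpace ↥(cechSet U J))
    (p : ℕ) (J : Nerve U p) : IsPathConnected (cechSet U J.1) := by
  haveI := hgood p J.1 J.2
  exact (isPathConnected_iff_pathConnectedSpace).2 inferInstance

/-- **The Čech cohomology of `0`-cocycles of a good open cover of a contractible space vanishes
in positive degrees** (`Ȟ^{p+1}(𝔘, Z⁰) ≅ H^{p+1}(Hom(C^𝔘, M)) ≅ H^{p+1}(X; M) = 0`: the tree's
`cechSingularEquiv`, `smallCochainCohomologyEquivDual`, `dualSmallHomologyIso`).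
[cite: BottTu1982Forms, Thm. 8.9 and Thm. 15.8] -/
theorem subsingleton_cohomology_cechZeroδ [ContractibleSpace X] (hU : ∀ i, IsOpen (U i))
    (hcov : (Set.univ : Set X) ⊆ ⋃ i, U i)
    (hgood : ∀ (p : ℕ) (J : Fin (p + 1) → ι), (cechSet U J).Nonempty → ContractibleSpace ↥(cechSet U J))
    (p : ℕ) :
    Subsingleton (Literature.Algebra.Homology.NatCochain.Cohomology (cechZeroδ R M U) (p + 1)) := by
  haveI : ContractibleSpace ↥(Set.univ : Set X) :=
    (Homeomorph.Set.univ X).contractibleSpace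
  have h0 : IsZero ((subsetCochains R (ModuleCat.of R M) (Set.univ : Set X)).homology (p + 1)) :=
    isZero_homology_subsetCochains_of_contractibleSpace _ (Nat.succ_ne_zero p)
  haveI : Subsingleton ((dualObj R (ModuleCat.of R M) (smallSub R R X U).toComplex).homology (p + 1)) :=
    ModuleCat.subsingleton_of_isZero (h0.of_iso (dualSmallHomologyIso U hU hcov (p + 1)).symm)
  haveI : Subsingleton (Literature.Algebra.Homology.NatCochain.Cohomology (cechSingularRow R M U).dA (p + 1)) :=
    (smallCochainCohomologyEquivDual (R := R) (N := M) U (p + 1)).toEquiv.subsingleton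
  exact (cechSingularEquiv U (hacyc_of_contractible hgood) (p + 1)).symm.toEquiv.subsingleton

/-- **Exactness of the Čech complex of functions in positive degrees**: for an open cover of a
contractible space all of whose non-empty finite intersections are contractible,
`Fun(N_p, M) → Fun(N_{p+1}, M) → Fun(N_{p+2}, M)` is exact. [cite: BottTu1982Forms, Thm. 8.9 and Thm. 15.8] -/
theorem cechFunD_exact_succ [ContractibleSpace X] (hU : ∀ i, IsOpen (U i))
    (hcov : (Set.univ : Set X) ⊆ ⋃ i, U i)
    (hgood : ∀ (p : ℕ) (J : Fin (p + 1) → ι), (cechSet U J).Nonempty → ContractibleSpace ↥(cechSet U J))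
    (p : ℕ) : Function.Exact (cechFunD R M U p) (cechFunD R M U (p + 1)) := by
  have hpc := isPathConnected_of_hgood hgood
  haveI := subsingleton_cohomology_cechZeroδ (R := R) (M := M) hU hcov hgood p
  intro f
  constructor
  · intro hf
    obtain ⟨b, rfl⟩ := cechTheta_surjective (R := R) (M := M) (U := U) (p + 1) f
    have hb : cechZeroδ R M U (p + 1) b = 0 := by
      apply cechTheta_injective hpc (p + 2)
      rw [cechTheta_cechZeroδ hpc, hf, map_zero]
    have hmem : b ∈ Literature.Algebra.Homology.NatCochain.cocycles (cechZeroδ R M U) (p + 1) :=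
      (Literature.Algebra.Homology.NatCochain.mem_cocycles_iff _).2 hb
    have hcls : Literature.Algebra.Homology.NatCochain.Cohomology.mk (cechZeroδ R M U) (p + 1)
        ⟨b, hmem⟩ = 0 := Subsingleton.elim _ _
    rw [Literature.Algebra.Homology.NatCochain.Cohomology.mk_eq_zero_iff,
      Literature.Algebra.Homology.NatCochain.mem_coboundaries_succ_iff] at hcls
    obtain ⟨b', hb'⟩ := hcls
    refine ⟨cechTheta R M U p b', ?_⟩
    rw [← cechTheta_cechZeroδ hpc, hb']
  · rintro ⟨g, rfl⟩
    exact cechFunD_cechFunD g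

/-- **Exactness at `Fun(N₀, M)`**: on a connected space covered by the open `U_i`, a function of
the index that agrees on overlapping indices is constant (it defines a locally constant function
on `X`). [cite: BottTu1982Forms, Prop. 8.5] -/
theorem cechFunCoaug_exact [PreconnectedSpace X] (hU : ∀ i, IsOpen (U i))
    (hcov : (Set.univ : Set X) ⊆ ⋃ i, U i) :
    Function.Exact (cechFunCoaug R M U) (cechFunD R M U 0) := by
  intro f
  constructor
  · intro hf
    -- the value on the index of a point
    have hidx : ∀ x : X, ∃ i, x ∈ U i := fun x => Set.mem_iUnion.1 (hcov (Set.mem_univ x))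
    choose idx hidx using hidx
    -- single-index simplices of the nerve
    have hne : ∀ i (x : X), x ∈ U i → (cechSet U (fun _ : Fin 1 => i)).Nonempty :=
      fun i x hx => ⟨x, (mem_cechSet_iff).2 fun _ => hx⟩
    let v : ∀ i (x : X), x ∈ U i → Nerve U 0 := fun i x hx => ⟨fun _ => i, hne i x hx⟩
    -- compatibility on overlaps from `δ f = 0`
    have hcompat : ∀ i i' (x : X) (hx : x ∈ U i) (hx' : x ∈ U i'), f (v i x hx) = f (v i' x hx') := by
      intro i i' x hx hx'
      have hJ : (cechSet U (Fin.cons i (fun _ : Fin 1 => i') : Fin (0 + 1 + 1) → ι)).Nonempty :=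
        ⟨x, by rw [cechSet_cons]; exact ⟨hx, (mem_cechSet_iff).2 fun _ => hx'⟩⟩
      let J₂ : Nerve U (0 + 1) := ⟨_, hJ⟩
      have h0 : Nerve.face 0 J₂ = v i' x hx' :=
        Subtype.ext (funext fun k => by rw [Nerve.coe_face, Function.comp_apply]; rfl)
      have h1 : Nerve.face 1 J₂ = v i x hx := Subtype.ext (funext fun k => by
        rw [Nerve.coe_face, Function.comp_apply, Fin.fin_one_eq_zero k]; rfl)
      have h := congrFun hf J₂
      rw [cechFunD_apply, Fin.sum_univ_two, h0, h1] at h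
      change _ = (0 : M) at h
      simp only [Fin.val_zero, pow_zero, one_smul, Fin.val_one, pow_one, neg_smul, one_smul] at h
      rw [← sub_eq_add_neg, sub_eq_zero] at h
      exact h.symm
    -- the locally constant function `x ↦ f [idx x]`
    let F : X → M := fun x => f (v (idx x) x (hidx x))
    have hF : IsLocallyConstant F := by
      refine (IsLocallyConstant.iff_exists_open F).2 fun x => ⟨U (idx x), hU _, hidx x, fun y hy => ?_⟩
      exact hcompat _ _ y (hidx y) hy
    have hconst : ∀ x y, F x = F y := fun x y => hF.apply_eq_of_preconnectedSpace x y
    -- `f` is the constant `F x₀`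
    by_cases hX : Nonempty X
    · obtain ⟨x₀⟩ := hX
      refine ⟨F x₀, funext fun J => ?_⟩
      obtain ⟨y, hy⟩ := J.2
      have hyi : y ∈ U (J.1 0) := (mem_cechSet_iff).1 hy 0
      have hJv : J = v (J.1 0) y hyi := Subtype.ext (funext fun k => by rw [Fin.fin_one_eq_zero k])
      rw [cechFunCoaug_apply, hconst x₀ y, hJv]
      exact hcompat _ _ y (hidx y) hyi
    · refine ⟨0, funext fun J => ?_⟩
      obtain ⟨y, _⟩ := J.2
      exact absurd ⟨y⟩ hX
  · rintro ⟨m, rfl⟩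
    exact cechFunD_cechFunCoaug m

end Topology

/-- The coaugmentation is injective as soon as `X` is non-empty and covered. [folklore] -/
theorem cechFunCoaug_injective [Nonempty X] (hcov : (Set.univ : Set X) ⊆ ⋃ i, U i) :
    Function.Injective (cechFunCoaug R M U) := by
  intro m m' h
  obtain ⟨x⟩ := ‹Nonempty X›
  obtain ⟨i, hi⟩ := Set.mem_iUnion.1 (hcov (Set.mem_univ x))
  have hJ : (cechSet U (fun _ : Fin 1 => i)).Nonempty := ⟨x, (mem_cechSet_iff).2 fun _ => hi⟩
  exact congrFun h ⟨_, hJ⟩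

end CechNerve

end Literature.AlgebraicTopology.SingularHomology
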